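import Literature.AlgebraicGeometry.HodgeTheory.MotivatedClassesDeformationInputs
import Literature.AlgebraicGeometry.Andre1996.CompactPencilReduction
import Literature.AlgebraicGeometry.HodgeTheory.TopDegreeClasses
import Literature.AlgebraicGeometry.Abdulali1994.CMReductionInvariantCycles
import Literature.AlgebraicGeometry.HodgeTheory.HodgeTypeProjectors
import Literature.AlgebraicGeometry.HodgeTheory.HodgeTypeVanishing
import Literature.AlgebraicGeometry.HodgeTheory.AlgebraicClassesHodgeTypeHolds
import Literature.AlgebraicGeometry.HodgeTheory.HodgeTypeExteriorProduct
import Literature.AlgebraicGeometry.HodgeTheory.HodgeConjectureQbarVoisinProofs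
import Literature.AlgebraicGeometry.HodgeTheory.ClassesSupportedOnComplexification
import Literature.AlgebraicGeometry.HodgeTheory.AlgebraicClassesFibreRestriction
import Literature.AlgebraicGeometry.HodgeTheory.SupportedClassesRationalProofs
import Literature.AlgebraicGeometry.Motives.HodgeStructureSubstructures
import Literature.AlgebraicGeometry.Motives.MotivatedCyclesAbelianPencilPieces
import HarnessLib

/-!
# Invariant cycles on a compact pencil of abelian varieties: the transport statement in four equivalent forms

For a compact pencil `f : 𝒳 ⟶ S` of abelian `d`-folds (`IsCompactAbelianPencil f d`: smooth projective total space of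
dimension `d + 1` over a smooth projective curve, abelian rational fibres) and the fibre inclusions `j_t : 𝒳_t ⟶ 𝒳`,
Abdulali's transport statement `InvariantCyclesHoldFor f d` ("a global class algebraic on one fibre is algebraic on
every fibre", Abdulali 1994 (1.1)) is rewritten without its rationality and Hodge-type binders.

* Part 1 — change of fibre (André 1996 §5.1 (A4), a theorem of the tree: flat sections over the connected `S(ℂ)`):
  `map_fiberι_eq_zero_of_eq_zero` — a global class vanishing on one fibre vanishes on every fibre.
* Part 2 — rigidity of the Hodge type of invariant classes (Deligne, Hodge II, Cor. 4.1.2 / (4.1.3.1) for the classes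
  coming from the total space): `typeProj_map_comm`, `isOfHodgeType_map_iff_forall_typeProj`, `isOfHodgeType_map_fiberι_iff`.
* Part 3 — rational lifts: `exists_isRationalClass_map_fiberι_eq` (a class rational on one fibre agrees on every fibre with a
  rational global class), `invariantCyclesHoldFor_iff_rational` ((1.1) for rational global classes, no Hodge binder).
* Part 4 — complex form and lattice form: `comap_complexBetti_map_le_span_isRationalClass` (preimages of rationally spanned
  subspaces are rationally spanned), `invariantCyclesHoldFor_iff_complex`, `invariantCyclesHoldFor_iff_comap_eq`
  (`(j_s^*)⁻¹ N^p(𝒳_s)` is independent of `s`), `algebraicClasses_sup_ker_le_comap` (`N^p(𝒳) ⊔ ker j_s^* ≤ (j_s^*)⁻¹ N^p(𝒳_s)`).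
* Part 5 — `ker_map_fiberι_eq`, `algebraicClasses_sup_ker_eq`: the right-hand side `N^p(𝒳) ⊔ ker j_s^*` is independent of `s`.

Theorems only; no definition, no named fact; nothing here asserts a case of the Hodge conjecture.

## References

* [Abdulali1994FamiliesAV] S. Abdulali, Algebraic cycles in families of abelian varieties, Canad. J. Math. 46 (1994), (1.1) p. 1122.
* [DeligneHodgeII1971] P. Deligne, Théorie de Hodge II, Publ. Math. IHÉS 40 (1971), Thm. 4.1.1, Cor. 4.1.2, (4.1.3.1).
* [Andre1996Motifs] Y. André, Pour une théorie inconditionnelle des motifs, Publ. Math. IHÉS 83 (1996), §5.1 (p. 25).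
* [VoisinHodgeI2002] C. Voisin, Hodge Theory and Complex Algebraic Geometry I, §6.1.3, §7.1.1, §7.3.2, §11.3.
* [VoisinHodgeII2003] C. Voisin, Hodge Theory and Complex Algebraic Geometry II, §3.1.2, §4.3.3.
* [GrothendieckTopology1969] A. Grothendieck, Hodge's general conjecture is false for trivial reasons, Topology 8 (1969), pp. 299–300.
* [CharlesSchnell2014Notes] F. Charles, C. Schnell, Notes on absolute Hodge classes, (11.3.1), Prop. 11.3.5.
* [Fulton1998] W. Fulton, Intersection Theory, §10.1, §19.2.
* [HatcherAT2002] A. Hatcher, Algebraic Topology, §3.1.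

Provenance: Literature home (namespace `Literature.AlgebraicGeometry.HodgeTheory.AbelianPencil`) of the used declarations of the
Summits-side `HodgeConjecture/Theorems/Ring2AbelianAllAndre{FibreClassPointwise (1/24), InvariantHodgeTypes (4/18),
InvariantRationality (4/16), TransportLattice (6/15), TransportLatticeCM (2/6)}` (namespace `…Ring2.AbelianAll`; imports
`Literature/` and Mathlib only), re-homed verbatim so that the Literature named facts
`Abdulali1994.Abdulali1994_invariantCycles_of_lefschetzStandard{,A}` can be discharged Literature-side
(`Literature/AlgebraicGeometry/Abdulali1994/LefschetzStandardTransportHolds.lean`). Layer 1/4.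
-/

noncomputable section

namespace Literature.AlgebraicGeometry.HodgeTheory.AbelianPencil

/-! ## Part 1: Change of fibre: a global class vanishing on one fibre vanishes on every fibre (André's (A4)) -/

section Part1

open _root_.CategoryTheory _root_.AlgebraicGeometry MonoidalCategory
open Literature.AlgebraicGeometry Literature.AlgebraicGeometry.Motives
open Literature.AlgebraicGeometry.HodgeTheory

variable {𝒳 S : SchemeOver ℂ}

/-! ## §1 The kernel identity reduces to one fibre (André's flatness input (A4) is a tree theorem) -/

/-- **Change of fibre is a theorem**: on a compact pencil, a global class vanishing on one fibre vanishes on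
every fibre (the tree's PROVED `Andre1996_deformation_hflat`: flat sections of `R^k f_* ℂ` over the connected
`S(ℂ)`; André §5.1 input (A4); Voisin II §3.1.2). [cite: Andre1996Motifs, §5.1 (p. 25)] [cite: VoisinHodgeII2003, §3.1.2] -/
theorem map_fiberι_eq_zero_of_eq_zero {d : ℕ} {f : 𝒳 ⟶ S} (hf : IsCompactAbelianPencil f d) {k : ℕ}
    {W : complexBetti 𝒳 k} {t : ComplexPoints S} (ht : complexBetti.map (fiberι f t) k W = 0)
    (s : ComplexPoints S) : complexBetti.map (fiberι f s) k W = 0 :=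
  Andre1996_deformation_hflat f hf.isSmoothProjectiveFamily (Andre1996.compactPencil_smooth_base hf)
    (IsQuasiProjectiveOver.of_isProjectiveOver hf.isSmoothProjective_base.isProjectiveOver)
    (connectedSpace_complexPoints hf.isSmoothProjective_base) k W t s ht

end Part1

/-! ## Part 2: Rigidity of the Hodge type of invariant classes (Deligne, Hodge II, Cor. 4.1.2) -/

section Part2

open _root_.CategoryTheory _root_.AlgebraicGeometry
open Literature.AlgebraicGeometry Literature.AlgebraicGeometry.Motives
open Literature.AlgebraicGeometry.HodgeTheory

/-! ## §1 Hodge-type projectors commute with pull-backs; the type of a pulled-back class -/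

section Morphisms

variable {m n : ℕ} {X Y : SchemeOver ℂ}

/-- Off the antidiagonal a Hodge type is empty: for `p + q ≠ k`, `c ∈ Hᵏ` is of type `(p,q)` iff `c = 0`
(there are no `(p,q)`-forms of degree `k`). [cite: VoisinHodgeI2002, §6.1.3 Thm. 6.18 and §7.1.1] -/
theorem isOfHodgeType_iff_eq_zero_of_add_ne (hX : IsSmoothProjective n X) {k p q : ℕ} (hpq : p + q ≠ k)
    (c : complexBetti X k) : IsOfHodgeType n X k p q c ↔ c = 0 := by
  obtain ⟨A⟩ := nonempty_hodgeModel_holds hX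
  refine ⟨?_, ?_⟩
  · rintro ⟨B, hB⟩
    have hbot : B.hodgePQ k p q = ⊥ :=
      (B.hodgePQ_eq_bot_iff k p q).2 (Literature.NumberTheory.Transcendental.hodgePQ_eq_bot_of_ne hpq)
    rw [hbot, Submodule.mem_bot] at hB
    exact B.pullback_injective k (by rw [hB, map_zero])
  · rintro rfl
    exact IsOfHodgeType.zero A k p q

/-- **The Hodge-type projectors commute with pull-back along a morphism of smooth projective varieties**:
`π^B_{(p,q)}(g^* c) = g^*(π^A_{(p,q)} c)` for Hodge models `A` of `X`, `B` of `Y` and `g : Y ⟶ X` — `g^* c =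
∑ g^*(π^A_{(p,q)} c)` is a decomposition into classes of the respective types (`g^*` preserves types, Voisin I
§7.3.2), and the type decomposition on `Y` is unique (Thm. 6.18). [cite: VoisinHodgeI2002, Thm. 6.18 and §7.3.2] -/
theorem typeProj_map_comm (hX : IsSmoothProjective n X) (hY : IsSmoothProjective m Y) (g : Y ⟶ X)
    (A : HodgeModel n X) (B : HodgeModel m Y) (k : ℕ) (pq : ↥(Finset.HasAntidiagonal.antidiagonal k))
    (c : complexBetti X k) :
    B.typeProj k pq (complexBetti.map g k c) = complexBetti.map g k (A.typeProj k pq c) := by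
  refine B.typeProj_eq_of_sum_eq (y := fun pq' ↦ complexBetti.map g k (A.typeProj k pq' c)) ?_ ?_ pq
  · intro pq'
    exact B.mem_typePiece_of_isOfHodgeType hodgePQ_independent_of_hodgeModel_holds hY pq'.2
      ((A.isOfHodgeType_of_mem_typePiece (A.typeProj_mem k pq' c)).map_of_isSmoothProjective hY hX g)
  · rw [← map_sum, A.sum_typeProj]

/-- **The type of a pulled-back class**: for `g : Y ⟶ X`, a Hodge model `A` of `X` and `p + q = k`, the class
`g^* c` is of type `(p,q)` on `Y` iff `g^*(π^A_{(p',q')} c) = 0` for every `(p',q') ≠ (p,q)` — i.e. iff all OTHER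
type components of `c` die under `g^*`. [cite: VoisinHodgeI2002, Thm. 6.18 and §7.3.2] -/
theorem isOfHodgeType_map_iff_forall_typeProj (hX : IsSmoothProjective n X) (hY : IsSmoothProjective m Y)
    (g : Y ⟶ X) (A : HodgeModel n X) {k p q : ℕ} (hpq : p + q = k) (c : complexBetti X k) :
    IsOfHodgeType m Y k p q (complexBetti.map g k c) ↔
      ∀ pq' : ↥(Finset.HasAntidiagonal.antidiagonal k), pq'.1 ≠ (p, q) →
        complexBetti.map g k (A.typeProj k pq' c) = 0 := by
  obtain ⟨B⟩ := nonempty_hodgeModel_holds hY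
  have hmem : (p, q) ∈ Finset.HasAntidiagonal.antidiagonal k := Finset.HasAntidiagonal.mem_antidiagonal.2 hpq
  refine ⟨fun h pq' hne ↦ ?_, fun h ↦ ?_⟩
  · have hcomm := typeProj_map_comm hX hY g A B k pq' c
    rw [← hcomm]
    exact B.typeProj_apply_of_mem_ne (pq := ⟨(p, q), hmem⟩) (fun heq ↦ hne (by rw [← heq]))
      (B.mem_typePiece_of_isOfHodgeType hodgePQ_independent_of_hodgeModel_holds hY hmem h)
  · have hsum : complexBetti.map g k c = complexBetti.map g k (A.typeProj k ⟨(p, q), hmem⟩ c) := by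
      conv_lhs => rw [← A.sum_typeProj k c, map_sum]
      rw [Finset.sum_eq_single ⟨(p, q), hmem⟩]
      · intro pq' _ hne
        exact h pq' fun heq ↦ hne (Subtype.ext heq)
      · intro habs
        exact absurd (Finset.mem_univ _) habs
    rw [hsum]
    exact (A.isOfHodgeType_of_mem_typePiece (A.typeProj_mem k ⟨(p, q), hmem⟩ c)).map_of_isSmoothProjective
      hY hX g

end Morphisms

variable {𝒳 S : SchemeOver ℂ}

/-! ## §2 Rigidity: the Hodge type of an invariant class does not depend on the fibre -/

/-- **RIGIDITY of the Hodge type of invariant classes (Deligne, Hodge II, Cor. 4.1.2 / (4.1.3.1) on the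
carriers).** On a compact pencil `f : 𝒳 ⟶ S` of abelian `d`-folds, for every class `W ∈ Hᵏ(𝒳(ℂ); ℂ)` and all
`s, t ∈ S(ℂ)`: `j_t^* W` is of Hodge type `(p,q)` on `𝒳_t` iff `j_s^* W` is of type `(p,q)` on `𝒳_s`. Proof: read
both in ONE Hodge model `A` of `𝒳` (§1: type `(p,q)` iff the other components `π^A_{(p',q')} W` die on the fibre)
and move the vanishing between fibres by André's flatness (A4) `map_fiberι_eq_zero_of_eq_zero` (a tree theorem).
"La structure de Hodge induite sur `H⁰(S, Rⁱf_*ℚ)` … est indépendante de `s`"; "(Griffiths) si une section globale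
… est de type de Hodge `(p,q)` en un point, alors elle est de type `(p,q)` partout". No named fact.
[cite: DeligneHodgeII1971, Cor. 4.1.2 and (4.1.3.1)] [cite: VoisinHodgeII2003, §4.3.3 Cor. 4.25]
[cite: Andre1996Motifs, §5.1 (p. 25)] -/
theorem isOfHodgeType_map_fiberι_iff {d : ℕ} {f : 𝒳 ⟶ S} (hf : IsCompactAbelianPencil f d) {k p q : ℕ}
    (W : complexBetti 𝒳 k) (s t : ComplexPoints S) :
    IsOfHodgeType d (fiberOver f t) k p q (complexBetti.map (fiberι f t) k W) ↔
      IsOfHodgeType d (fiberOver f s) k p q (complexBetti.map (fiberι f s) k W) := by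
  have h𝒳 := hf.isSmoothProjective_total
  by_cases hpq : p + q = k
  · obtain ⟨A⟩ := nonempty_hodgeModel_holds h𝒳
    rw [isOfHodgeType_map_iff_forall_typeProj h𝒳 (hf.isSmoothProjective_fiberOver t) (fiberι f t) A hpq,
      isOfHodgeType_map_iff_forall_typeProj h𝒳 (hf.isSmoothProjective_fiberOver s) (fiberι f s) A hpq]
    exact forall₂_congr fun pq' _ ↦
      ⟨fun h ↦ map_fiberι_eq_zero_of_eq_zero hf h s, fun h ↦ map_fiberι_eq_zero_of_eq_zero hf h t⟩
  · rw [isOfHodgeType_iff_eq_zero_of_add_ne (hf.isSmoothProjective_fiberOver t) hpq,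
      isOfHodgeType_iff_eq_zero_of_add_ne (hf.isSmoothProjective_fiberOver s) hpq]
    exact ⟨fun h ↦ map_fiberι_eq_zero_of_eq_zero hf h s, fun h ↦ map_fiberι_eq_zero_of_eq_zero hf h t⟩

end Part2

/-! ## Part 3: Rational lifts; (1.1) for rational classes without the Hodge binder -/

section Part3

open _root_.CategoryTheory _root_.AlgebraicGeometry
open Literature.AlgebraicGeometry Literature.AlgebraicGeometry.Motives
open Literature.AlgebraicGeometry.HodgeTheory
open Literature.AlgebraicGeometry.Abdulali1994 (InvariantCyclesHoldFor)

variable {𝒳 S : SchemeOver ℂ}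

/-! ## §1 Rational lifts along the pencil; rationality rigidity; Hodge-class rigidity -/

/-- **A class rational on ONE fibre agrees on EVERY fibre with a rational class of the total space.** On a
compact pencil `f : 𝒳 ⟶ S` of abelian `d`-folds, if `j_t^* W` is rational then there is a RATIONAL
`W₀ ∈ Hᵏ(𝒳(ℂ); ℂ)` with `j_s^* W₀ = j_s^* W` for all `s`: rational descent of ranges for `j_t : 𝒳_t ⟶ 𝒳` (a
rational class in `im (j_t^* ⊗ ℂ)` is `j_t^*` of a rational class — universal coefficients on the smooth
projective `𝒳`, the tree's `exists_isRationalClass_complexBetti_map_eq`) gives `W₀` with `j_t^* W₀ = j_t^* W`, and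
`W - W₀` dies on `𝒳_t`, hence on every fibre (André's flatness (A4), `map_fiberι_eq_zero_of_eq_zero`).
[cite: VoisinHodgeI2002, §7.1.1] [cite: HatcherAT2002, §3.1 Thm. 3.2 and p. 198] [cite: Andre1996Motifs, §5.1 (p. 25)] -/
theorem exists_isRationalClass_map_fiberι_eq {d : ℕ} {f : 𝒳 ⟶ S} (hf : IsCompactAbelianPencil f d) {k : ℕ}
    (W : complexBetti 𝒳 k) {t : ComplexPoints S} (ht : IsRationalClass (complexBetti.map (fiberι f t) k W)) :
    ∃ W₀ : complexBetti 𝒳 k, IsRationalClass W₀ ∧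
      ∀ s : ComplexPoints S, complexBetti.map (fiberι f s) k W₀ = complexBetti.map (fiberι f s) k W := by
  obtain ⟨W₀, hW₀, hW₀t⟩ := exists_isRationalClass_complexBetti_map_eq hf.isSmoothProjective_total (fiberι f t) W ht
  refine ⟨W₀, hW₀, fun s ↦ ?_⟩
  have h0 : complexBetti.map (fiberι f t) k (W₀ - W) = 0 := by rw [map_sub, hW₀t, sub_self]
  have hs : complexBetti.map (fiberι f s) k (W₀ - W) = 0 := map_fiberι_eq_zero_of_eq_zero hf h0 s
  rwa [map_sub, sub_eq_zero] at hs

/-- **A rational global class which is ALGEBRAIC on one fibre satisfies the fibrewise Hodge binder**: its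
restrictions are rational (pull-backs of a rational class) and of type `(p,p)` on the algebraic fibre (algebraic
classes are of type `(p,p)`, the tree's `isOfHodgeType_of_mem_algebraicClasses_of_isSmoothProjective`), hence on
every fibre (part XVI-a's rigidity). [cite: VoisinHodgeI2002, §11.3 Prop. 11.20] [cite: DeligneHodgeII1971, (4.1.3.1)] -/
theorem fibrewiseHodge_of_isRationalClass_of_mem_algebraicClasses {d : ℕ} {f : 𝒳 ⟶ S}
    (hf : IsCompactAbelianPencil f d) {p : ℕ} {W : complexBetti 𝒳 (2 * p)} (hW : IsRationalClass W)
    {t : ComplexPoints S} (ht : complexBetti.map (fiberι f t) (2 * p) W ∈ algebraicClasses (fiberOver f t) p)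
    (s : ComplexPoints S) :
    IsRationalClass (complexBetti.map (fiberι f s) (2 * p) W) ∧
      IsOfHodgeType d (fiberOver f s) (2 * p) p p (complexBetti.map (fiberι f s) (2 * p) W) :=
  ⟨hW.map (AlgPoints.mapContinuous (L := ℂ) (fiberι f s)),
    (isOfHodgeType_map_fiberι_iff hf W s t).1
      (isOfHodgeType_of_mem_algebraicClasses_of_isSmoothProjective (hf.isSmoothProjective_fiberOver t) p ht)⟩

/-- **A class satisfying the fibrewise Hodge binder has the fibre restrictions of a RATIONAL global class** (only
rationality at one fibre is used). [cite: VoisinHodgeI2002, §7.1.1] [cite: Andre1996Motifs, §5.1 (p. 25)] -/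
theorem exists_isRationalClass_map_fiberι_eq_of_fibrewiseHodge {d : ℕ} {f : 𝒳 ⟶ S}
    (hf : IsCompactAbelianPencil f d) {p : ℕ} (W : complexBetti 𝒳 (2 * p))
    (hW : ∀ s : ComplexPoints S, IsRationalClass (complexBetti.map (fiberι f s) (2 * p) W) ∧
      IsOfHodgeType d (fiberOver f s) (2 * p) p p (complexBetti.map (fiberι f s) (2 * p) W))
    (t : ComplexPoints S) :
    ∃ W₀ : complexBetti 𝒳 (2 * p), IsRationalClass W₀ ∧
      ∀ s : ComplexPoints S, complexBetti.map (fiberι f s) (2 * p) W₀ = complexBetti.map (fiberι f s) (2 * p) W :=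
  exists_isRationalClass_map_fiberι_eq hf W (hW t).1

/-! ## §3 The nodes for rational classes of the total space, with no Hodge-type hypothesis -/

/-- **(1.1)_f without its Hodge binder.** On a compact pencil of abelian `d`-folds, Abdulali's transport statement
`InvariantCyclesHoldFor f d` is EQUIVALENT to: for every `p` and every RATIONAL `W ∈ H²ᵖ(𝒳(ℂ); ℂ)`, if `j_{s₀}^* W`
is algebraic for one `s₀` then `j_s^* W` is algebraic for every `s`. [cite: Abdulali1994FamiliesAV, (1.1) (p. 1122)]
[cite: CharlesSchnell2014Notes, (11.3.1) and Prop. 11.3.5] [cite: DeligneHodgeII1971, Cor. 4.1.2] -/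
theorem invariantCyclesHoldFor_iff_rational {d : ℕ} {f : 𝒳 ⟶ S} (hf : IsCompactAbelianPencil f d) :
    InvariantCyclesHoldFor f d ↔ ∀ (p : ℕ) (W : complexBetti 𝒳 (2 * p)), IsRationalClass W →
      (∃ s₀ : ComplexPoints S, complexBetti.map (fiberι f s₀) (2 * p) W ∈ algebraicClasses (fiberOver f s₀) p) →
      ∀ s : ComplexPoints S, complexBetti.map (fiberι f s) (2 * p) W ∈ algebraicClasses (fiberOver f s) p := by
  refine ⟨fun h p W hW hs₀ ↦ ?_, fun h p W hW hs₀ s ↦ ?_⟩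
  · obtain ⟨s₀, h₀⟩ := hs₀
    exact h p W (fibrewiseHodge_of_isRationalClass_of_mem_algebraicClasses hf hW h₀) ⟨s₀, h₀⟩
  · obtain ⟨s₀, h₀⟩ := hs₀
    obtain ⟨W₀, hW₀, hW₀s⟩ := exists_isRationalClass_map_fiberι_eq_of_fibrewiseHodge hf W hW s₀
    rw [← hW₀s s]
    exact h p W₀ hW₀ ⟨s₀, by rw [hW₀s s₀]; exact h₀⟩ s

end Part3

/-! ## Part 4: (1.1) on complex cohomology and in lattice form -/

section Part4

open scoped TensorProduct

open _root_.CategoryTheory _root_.AlgebraicGeometry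
open Literature.AlgebraicGeometry Literature.AlgebraicGeometry.Motives
open Literature.AlgebraicGeometry.HodgeTheory
open Literature.AlgebraicGeometry.Abdulali1994 (InvariantCyclesHoldFor)

/-! ## §1 Base change commutes with preimages -/

section LinearAlgebra

universe u v

variable {V : Type u} [AddCommGroup V] [Module ℚ V] {V' : Type v} [AddCommGroup V'] [Module ℚ V']

/-- **`(φ⁻¹ P) ⊗ ℂ = (φ ⊗ ℂ)⁻¹ (P ⊗ ℂ)`** for a `ℚ`-linear map `φ : V' → V` and a `ℚ`-subspace `P ⊆ V` (`ℂ` is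
flat over `ℚ`: `P = ker (V → V/P)`, `φ⁻¹ P = ker (V' → V → V/P)`, and base change commutes with kernels — the
tree's `Motives.HodgeStructure.mem_baseChange_ker_iff`, twice). [cite: Abdulali1994FamiliesAV, (1.1) p. 1122] -/
theorem mem_baseChange_comap_iff (φ : V' →ₗ[ℚ] V) (P : Submodule ℚ V) (x : ℂ ⊗[ℚ] V') :
    x ∈ (P.comap φ).baseChange ℂ ↔ φ.baseChange ℂ x ∈ P.baseChange ℂ := by
  have hP : P.comap φ = LinearMap.ker (P.mkQ ∘ₗ φ) := by rw [LinearMap.ker_comp, Submodule.ker_mkQ]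
  rw [hP, HodgeStructure.mem_baseChange_ker_iff, LinearMap.baseChange_comp, LinearMap.comp_apply]
  conv_rhs => rw [← Submodule.ker_mkQ P]
  rw [HodgeStructure.mem_baseChange_ker_iff]

end LinearAlgebra

/-! ## §2 Preimages of rationally spanned subspaces are rationally spanned -/

section Morphisms

variable {n : ℕ} {X Y : SchemeOver ℂ}

/-- **The preimage under `g^*` of a rationally spanned subspace is rationally spanned.** Let `g : Y ⟶ X` be a
morphism into a smooth projective `X` and `A ⊆ Hᵏ(Y(ℂ); ℂ)` a `ℂ`-subspace contained in the span of its rational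
classes. Then every `W ∈ Hᵏ(X(ℂ); ℂ)` with `g^* W ∈ A` is a `ℂ`-linear combination of RATIONAL classes `W'` with
`g^* W' ∈ A`. Proof: with `β : Hᵏ(–; ℚ) ⊗ ℂ → Hᵏ(–; ℂ)` (onto for `X`, injective for `Y`; universal coefficients)
and `A_ℚ = {a | a ⊗ 1 ∈ A}`, `β_Y⁻¹ A ⊆ A_ℚ ⊗ ℂ`; writing `W = β_X(τ)`, naturality gives
`(g^* ⊗ ℂ) τ ∈ A_ℚ ⊗ ℂ`, so `τ ∈ ((g^*)⁻¹ A_ℚ) ⊗ ℂ` (§1), a combination of vectors `1 ⊗ w` with `g^* w ∈ A_ℚ`.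
[cite: VoisinHodgeI2002, §7.1.1] [cite: HatcherAT2002, §3.1 Thm. 3.2 and p. 198] -/
theorem comap_complexBetti_map_le_span_isRationalClass (hX : IsSmoothProjective n X) (g : Y ⟶ X) {k : ℕ}
    (A : Submodule ℂ (complexBetti Y k))
    (hA : A ≤ Submodule.span ℂ {c : complexBetti Y k | IsRationalClass c ∧ c ∈ A})
    {W : complexBetti X k} (hW : complexBetti.map g k W ∈ A) :
    W ∈ Submodule.span ℂ {W' : complexBetti X k | IsRationalClass W' ∧ complexBetti.map g k W' ∈ A} := by
  set βY := ofRatClassBaseChange (ComplexPoints Y) k with hβY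
  -- the `ℚ`-form of `A`
  let Aℚ : Submodule ℚ (bettiCohomology Y k) :=
    ((A.comap βY).restrictScalars ℚ).comap HodgeStructure.ofRat
  have hAℚ : ∀ a : bettiCohomology Y k, a ∈ Aℚ ↔ ofRatClass (ComplexPoints Y) k a ∈ A := fun a ↦ by
    change βY (HodgeStructure.ofRat a) ∈ A ↔ _
    rw [hβY, ofRatClassBaseChange_ofRat]
  -- `β_Y⁻¹ A ⊆ A_ℚ ⊗ ℂ`
  have h1 : ∀ x, βY x ∈ A → x ∈ Aℚ.baseChange ℂ := by
    intro x hx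
    have hle : Submodule.span ℂ {c : complexBetti Y k | IsRationalClass c ∧ c ∈ A} ≤
        (Aℚ.baseChange ℂ).map βY := by
      refine Submodule.span_le.2 ?_
      rintro c ⟨hc, hcA⟩
      obtain ⟨a, rfl⟩ := (isRationalClass_iff_mem_range_ofRatClass c).1 hc
      refine ⟨HodgeStructure.ofRat a, ?_, by rw [hβY, ofRatClassBaseChange_ofRat]⟩
      rw [HodgeStructure.ofRat_apply]
      exact Submodule.tmul_mem_baseChange_of_mem 1 ((hAℚ a).2 hcA)
    obtain ⟨y, hy, hyx⟩ := hle (hA hx)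
    rwa [← ofRatClassBaseChange_injective _ k hyx]
  -- write `W = β_X τ` and move through naturality
  obtain ⟨τ, rfl⟩ := ofRatClassBaseChange_surjective hX k W
  set φ : bettiCohomology X k →ₗ[ℚ] bettiCohomology Y k := (bettiCohomology.map g k).hom with hφ
  have hnat : ∀ t, complexBetti.map g k (ofRatClassBaseChange (ComplexPoints X) k t) = βY (φ.baseChange ℂ t) :=
    fun t ↦ map_ofRatClassBaseChange (g := AlgPoints.mapContinuous (L := ℂ) g) (t := t)
  have hτ : τ ∈ (Aℚ.comap φ).baseChange ℂ := by
    rw [mem_baseChange_comap_iff]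
    exact h1 _ (by rw [← hnat]; exact hW)
  -- the generators `1 ⊗ w`, `g^* w ∈ A_ℚ`, go to rational classes `w ⊗ 1` with `g^*(w ⊗ 1) ∈ A`
  rw [Submodule.baseChange_eq_span] at hτ
  have hmap : ofRatClassBaseChange (ComplexPoints X) k τ ∈
      (Submodule.span ℂ ((Aℚ.comap φ).map (TensorProduct.mk ℚ ℂ (bettiCohomology X k) 1) :
        Set (ℂ ⊗[ℚ] bettiCohomology X k))).map (ofRatClassBaseChange (ComplexPoints X) k) :=
    Submodule.mem_map_of_mem hτ
  rw [Submodule.map_span] at hmap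
  refine Submodule.span_mono ?_ hmap
  rintro _ ⟨_, ⟨w, hw, rfl⟩, rfl⟩
  have hw' : ofRatClass (ComplexPoints Y) k (φ w) ∈ A := (hAℚ _).1 (Submodule.mem_comap.1 hw)
  refine ⟨?_, ?_⟩
  · change IsRationalClass (ofRatClassBaseChange (ComplexPoints X) k ((1 : ℂ) ⊗ₜ[ℚ] w))
    rw [ofRatClassBaseChange_tmul, one_smul]
    exact isRationalClass_ofRatClass w
  · change complexBetti.map g k (ofRatClassBaseChange (ComplexPoints X) k ((1 : ℂ) ⊗ₜ[ℚ] w)) ∈ A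
    rw [ofRatClassBaseChange_tmul, one_smul]
    have hm : complexBetti.map g k (ofRatClass (ComplexPoints X) k w) = ofRatClass (ComplexPoints Y) k (φ w) :=
      (ofRatClass_map (f := AlgPoints.mapContinuous (L := ℂ) g) (a := w)).symm
    rw [hm]
    exact hw'

end Morphisms

variable {𝒳 S : SchemeOver ℂ}

/-- **On a compact pencil, a global class algebraic on the fibre `𝒳_t` is a `ℂ`-combination of RATIONAL global
classes algebraic on `𝒳_t`** (§2 for `j_t : 𝒳_t ⟶ 𝒳` and `A = N^p(𝒳_t)`, which is spanned by its rational
classes: Grothendieck's `N^p ⊗ ℂ`, the tree's `supportedClasses_le_span_isRationalClass`).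
[cite: GrothendieckTopology1969, §1 pp. 299–300] [cite: VoisinHodgeI2002, §7.1.1] -/
theorem mem_span_rational_of_map_fiberι_mem_algebraicClasses {d : ℕ} {f : 𝒳 ⟶ S}
    (hf : IsCompactAbelianPencil f d) {p : ℕ} {W : complexBetti 𝒳 (2 * p)} {t : ComplexPoints S}
    (hW : complexBetti.map (fiberι f t) (2 * p) W ∈ algebraicClasses (fiberOver f t) p) :
    W ∈ Submodule.span ℂ {W' : complexBetti 𝒳 (2 * p) | IsRationalClass W' ∧
      complexBetti.map (fiberι f t) (2 * p) W' ∈ algebraicClasses (fiberOver f t) p} :=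
  comap_complexBetti_map_le_span_isRationalClass hf.isSmoothProjective_total (fiberι f t)
    (algebraicClasses (fiberOver f t) p)
    (supportedClasses_le_span_isRationalClass (hf.isSmoothProjective_fiberOver t) (2 * p) p) hW

/-! ## §3 The nodes on complex cohomology: no rationality, no Hodge type -/

/-- **(1.1)_f on complex cohomology.** On a compact pencil of abelian `d`-folds, `InvariantCyclesHoldFor f d` ⟺ for
every `p` and EVERY `W ∈ H²ᵖ(𝒳(ℂ); ℂ)`: `j_{s₀}^* W ∈ N^p(𝒳_{s₀})` for one `s₀` implies `j_s^* W ∈ N^p(𝒳_s)` for all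
`s`. [cite: Abdulali1994FamiliesAV, (1.1) (p. 1122)] [cite: GrothendieckTopology1969, §1 pp. 299–300] -/
theorem invariantCyclesHoldFor_iff_complex {d : ℕ} {f : 𝒳 ⟶ S} (hf : IsCompactAbelianPencil f d) :
    InvariantCyclesHoldFor f d ↔ ∀ (p : ℕ) (W : complexBetti 𝒳 (2 * p)),
      (∃ s₀ : ComplexPoints S, complexBetti.map (fiberι f s₀) (2 * p) W ∈ algebraicClasses (fiberOver f s₀) p) →
      ∀ s : ComplexPoints S, complexBetti.map (fiberι f s) (2 * p) W ∈ algebraicClasses (fiberOver f s) p := by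
  rw [invariantCyclesHoldFor_iff_rational hf]
  refine ⟨fun h p W hs₀ s ↦ ?_, fun h p W _ hs₀ ↦ h p W hs₀⟩
  obtain ⟨s₀, h₀⟩ := hs₀
  refine (Submodule.span_le (p := (algebraicClasses (fiberOver f s) p).comap
      (complexBetti.map (fiberι f s) (2 * p)).hom)).2 ?_
    (mem_span_rational_of_map_fiberι_mem_algebraicClasses hf h₀)
  rintro W' ⟨hW', hW't⟩
  exact h p W' hW' ⟨s₀, hW't⟩ s

/-- **(1.1)_f in lattice form**: on a compact pencil, `InvariantCyclesHoldFor f d` ⟺ the subspace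
`(j_s^*)⁻¹ N^p(𝒳_s) ⊆ H²ᵖ(𝒳(ℂ); ℂ)` of global classes algebraic on `𝒳_s` does not depend on `s`.
[cite: Abdulali1994FamiliesAV, (1.1) (p. 1122)] [cite: CharlesSchnell2014Notes, (11.3.1)] -/
theorem invariantCyclesHoldFor_iff_comap_eq {d : ℕ} {f : 𝒳 ⟶ S} (hf : IsCompactAbelianPencil f d) :
    InvariantCyclesHoldFor f d ↔ ∀ (p : ℕ) (s s' : ComplexPoints S),
      (algebraicClasses (fiberOver f s) p).comap (complexBetti.map (fiberι f s) (2 * p)).hom =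
        (algebraicClasses (fiberOver f s') p).comap (complexBetti.map (fiberι f s') (2 * p)).hom := by
  rw [invariantCyclesHoldFor_iff_complex hf]
  refine ⟨fun h p s s' ↦ le_antisymm (fun W hW ↦ h p W ⟨s, hW⟩ s') (fun W hW ↦ h p W ⟨s', hW⟩ s),
    fun h p W hs₀ s ↦ ?_⟩
  obtain ⟨s₀, h₀⟩ := hs₀
  have hmem : W ∈ (algebraicClasses (fiberOver f s₀) p).comap (complexBetti.map (fiberι f s₀) (2 * p)).hom := h₀
  rw [h p s₀ s] at hmem
  exact hmem

/-- **`N^p(𝒳) ⊔ ker j_s^* ≤ (j_s^*)⁻¹ N^p(𝒳_s)` always**: algebraic classes of the total space restrict to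
algebraic classes of the fibre (the tree's `map_fiberι_mem_algebraicClasses`, Fulton Cor. 10.1 / 19.2 (b)).
[cite: Fulton1998, §10.1 Cor. 10.1 and §19.2 Cor. 19.2 (b)] -/
theorem algebraicClasses_sup_ker_le_comap {d : ℕ} {f : 𝒳 ⟶ S} (hf : IsCompactAbelianPencil f d) (p : ℕ)
    (s : ComplexPoints S) :
    algebraicClasses 𝒳 p ⊔ LinearMap.ker (complexBetti.map (fiberι f s) (2 * p)).hom ≤
      (algebraicClasses (fiberOver f s) p).comap (complexBetti.map (fiberι f s) (2 * p)).hom := by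
  have hSqp : IsQuasiProjectiveOver S :=
    IsQuasiProjectiveOver.of_isProjectiveOver hf.isSmoothProjective_base.isProjectiveOver
  have hS : AlgebraicGeometry.Smooth S.hom := Andre1996.compactPencil_smooth_base hf
  haveI : IrreducibleSpace S.left := Andre1996.compactPencil_irreducibleSpace_base hf
  haveI := hS
  refine sup_le (fun η hη ↦ ?_) (fun κ hκ ↦ ?_)
  · exact map_fiberι_mem_algebraicClasses f hf.isSmoothProjectiveFamily hSqp hη s
  · rw [LinearMap.mem_ker] at hκ
    change (complexBetti.map (fiberι f s) (2 * p)).hom κ ∈ algebraicClasses (fiberOver f s) p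
    rw [hκ]
    exact Submodule.zero_mem _

end Part4

/-! ## Part 5: The kernels of the fibre restrictions coincide -/

section Part5

open _root_.CategoryTheory _root_.AlgebraicGeometry
open Literature.AlgebraicGeometry Literature.AlgebraicGeometry.Motives
open Literature.AlgebraicGeometry.HodgeTheory

variable {𝒳 S : SchemeOver ℂ}

/-! ## §1 The kernels of the fibre restrictions coincide -/

/-- **`ker j_s^* = ker j_t^*`** on a compact pencil of abelian `d`-folds, in every degree (André's flatness (A4),
`map_fiberι_eq_zero_of_eq_zero`: the restrictions of a global class form a flat section over the connected base).
[cite: Andre1996Motifs, §5.1 (p. 25)] [cite: DeligneHodgeII1971, Thm. 4.1.1] -/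
theorem ker_map_fiberι_eq {d : ℕ} {f : 𝒳 ⟶ S} (hf : IsCompactAbelianPencil f d) (k : ℕ) (s t : ComplexPoints S) :
    LinearMap.ker (complexBetti.map (fiberι f s) k).hom = LinearMap.ker (complexBetti.map (fiberι f t) k).hom := by
  ext W
  simp only [LinearMap.mem_ker]
  exact ⟨fun h ↦ map_fiberι_eq_zero_of_eq_zero hf h t, fun h ↦ map_fiberι_eq_zero_of_eq_zero hf h s⟩

/-- Hence `N^p(𝒳) ⊔ ker j_s^* = N^p(𝒳) ⊔ ker j_t^*`: the right-hand side of part XVII-b's lattice identities does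
not depend on the fibre. [cite: Andre1996Motifs, §5.1 (p. 25)] -/
theorem algebraicClasses_sup_ker_eq {d : ℕ} {f : 𝒳 ⟶ S} (hf : IsCompactAbelianPencil f d) (p : ℕ)
    (s t : ComplexPoints S) :
    algebraicClasses 𝒳 p ⊔ LinearMap.ker (complexBetti.map (fiberι f s) (2 * p)).hom =
      algebraicClasses 𝒳 p ⊔ LinearMap.ker (complexBetti.map (fiberι f t) (2 * p)).hom := by
  rw [ker_map_fiberι_eq hf (2 * p) s t]

end Part5

end Literature.AlgebraicGeometry.HodgeTheory.AbelianPencil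

end
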